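import Summits.BirchSwinnertonDyer.BirchSwinnertonDyer.Theses.SmallImageMuTransfer
import Literature.NumberTheory.EllipticCurves.AnalyticRankModularityProofs
import Literature.NumberTheory.EllipticCurves.ModularParametrizationBCDTProofs
import Literature.NumberTheory.EllipticCurves.SkinnerUrban2014.PAdicUnitPeriodRatioProofs
import Literature.NumberTheory.EllipticCurves.IwasawaLeadingTermOddPrime
import HarnessLib

/-!
# Route `SmallImageMuTransfer` (K6), support item `PublishedInputsX9` (stmt-BirchSwinnertonDyer-19632):
# the SLIMMED dependency list — the eight-conjunct print pack from its irredundant displayed inputs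

D-0154 (2) INPUTS→UNCONDITIONAL, `INPUTS-LIST-2.md` §4 T1 «PackSlim» (cell `pub/bsd-wall`, seat
`bsd-inputs-pack-p1`). `PublishedInputsX9` is the conjunction of the eight PUBLISHED named facts the
kernel bridge `bsdpOnClassX9_of_katoMuTransfer` consumes: BCS 2025 Thm 1.1.2 (a)
(`BCSCharIdealEqPadicLFunction`, 19459), Greenberg LNM 1716 Thm 4.1 (`GreenbergCharValueRankZero`,
19460), the period unit at good `p ≥ 5` (`RealPeriodUnitPlusPeriod`, 19290), Schneider 1985 and
Perrin-Riou 1987 (together the child `IwasawaLeadingTermFactsX9`; asides 19468 / 19469), modular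
parametrisation data (`ModularParametrizationSupply`, 19266), entireness of `L(E,s)`
(`EntireLFunctionRat`, 19273), Gross–Zagier–Kolyvagin (`RankEqAnalyticRankLeOne`, 19921). Over the
tree's LANDED theorems:

* `EntireLFunctionRat` is redundant given `ModularParametrizationSupply`: the datum gives the newform
  (`ModularForms.exists_isNewformOf_of_nonempty_modularParametrizationData`, BCDT 2001 p. 845 (6) ⇒ (2),
  `ModularParametrizationBCDTProofs.lean`) and the newform the entire continuation
  (`WeierstrassCurve.hasEntireLFunction_rat_of_exists_isNewformOf`, `AnalyticRankModularityProofs.lean`);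
* the period unit follows from the printed primary Mazur 1978 Cor. 4.1
  (`ModularForms.mazur_not_dvd_maninConstant_of_odd`) by
  `SkinnerUrban2014.realPeriodRat_eq_unit_mul_plusPeriod_of_mazur`;
* Schneider 1985 at `p ≥ 5` (`Schneider1985_order_charGenerator`) is the narrowing of the printed
  odd-prime theorem `Schneider1985_order_charGenerator_odd` (`Schneider1985_order_charGenerator.of_odd`,
  `IwasawaLeadingTermOddPrime.lean`).

Theorems: `smallImageMuTransfer_publishedInputsX9_of_slim` — the pack from SIX registered children
(all but `EntireLFunctionRat`; 8 conjunct slots → 7 facts); `smallImageMuTransfer_publishedInputsX9_of_slim_primaries`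
— the same with the period unit and Schneider's theorem fed from their printed primaries (Mazur
Cor. 4.1, Schneider at odd `p`); and the in-route edge
`smallImageMuTransfer_entireLFunctionRat_of_modularParametrizationSupply`. HONEST FRAMING: pure glue
over landed theorems; no cite-only fact is proved here; the remaining inputs stay print hypotheses and
the route stays conditional on them AS TYPED. Nothing here proves BSD; BSD is not proved by any of this.
-/

set_option autoImplicit false
set_option linter.dupNamespace false

namespace Summit.BirchSwinnertonDyer.BirchSwinnertonDyer.Theorems

open Literature.NumberTheory.EllipticCurves
open Summit.BirchSwinnertonDyer.BirchSwinnertonDyer.Theses.SmallImageMuTransfer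

/-- In-route edge (route `SmallImageMuTransfer`): `ModularParametrizationSupply` (19266) gives
`EntireLFunctionRat` (19273) — datum ⇒ newform
(`ModularForms.exists_isNewformOf_of_nonempty_modularParametrizationData`) ⇒ entire continuation
(`WeierstrassCurve.hasEntireLFunction_rat_of_exists_isNewformOf`). [folklore] -/
theorem smallImageMuTransfer_entireLFunctionRat_of_modularParametrizationSupply
    (hparam : ModularParametrizationSupply) :
    Summit.BirchSwinnertonDyer.BirchSwinnertonDyer.Theses.SmallImageMuTransfer.EntireLFunctionRat :=
  WeierstrassCurve.hasEntireLFunction_rat_of_exists_isNewformOf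
    (ModularForms.exists_isNewformOf_of_nonempty_modularParametrizationData hparam)

/-- **`PublishedInputsX9` (K6) from six registered children, BY NAME** (route `SmallImageMuTransfer`,
item stmt-BirchSwinnertonDyer-19632; INPUTS-LIST-2 T1): `BCSCharIdealEqPadicLFunction`,
`GreenbergCharValueRankZero`, `RealPeriodUnitPlusPeriod`, `IwasawaLeadingTermFactsX9` (Schneider ∧
Perrin-Riou), `ModularParametrizationSupply`, `RankEqAnalyticRankLeOne` imply the eight-conjunct pack,
conjunct 7 (entire continuation) being the tree theorem
`smallImageMuTransfer_entireLFunctionRat_of_modularParametrizationSupply`. Pure glue; the hypotheses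
remain print inputs. [folklore] -/
theorem smallImageMuTransfer_publishedInputsX9_of_slim
    (hBCS : BCSCharIdealEqPadicLFunction) (hGr : GreenbergCharValueRankZero)
    (hPer : RealPeriodUnitPlusPeriod) (hLT : IwasawaLeadingTermFactsX9)
    (hparam : ModularParametrizationSupply) (hGZK : RankEqAnalyticRankLeOne) :
    Summit.BirchSwinnertonDyer.BirchSwinnertonDyer.Theses.SmallImageMuTransfer.PublishedInputsX9 :=
  ⟨hBCS, hGr, hPer, hLT.1, hLT.2, hparam,
    smallImageMuTransfer_entireLFunctionRat_of_modularParametrizationSupply hparam, hGZK⟩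

/-- **`PublishedInputsX9` (K6) with the period unit and Schneider's theorem fed from their printed
primaries**: as `smallImageMuTransfer_publishedInputsX9_of_slim`, but conjunct 3 (`Ω_E = u · Ω⁺_f` at
good `p ≥ 5`) is supplied from Mazur 1978 Cor. 4.1 `ModularForms.mazur_not_dvd_maninConstant_of_odd` by
`SkinnerUrban2014.realPeriodRat_eq_unit_mul_plusPeriod_of_mazur`, and conjunct 4 (Schneider 1985 at
`p ≥ 5`) from the printed odd-prime statement `Schneider1985_order_charGenerator_odd`
(Balakrishnan–Müller–Stein 2015 Thm 1.7; route PrintX10b's item 19470) by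
`Schneider1985_order_charGenerator.of_odd`; Perrin-Riou 1987 is the aside
`PerrinRiouRankOneLeadingTerms` (19469). Pure glue; the seven hypotheses remain print inputs.
[folklore] -/
theorem smallImageMuTransfer_publishedInputsX9_of_slim_primaries
    (hBCS : BCSCharIdealEqPadicLFunction) (hGr : GreenbergCharValueRankZero)
    (hMazur : ModularForms.mazur_not_dvd_maninConstant_of_odd)
    (hSch : Schneider1985_order_charGenerator_odd) (hPR : PerrinRiouRankOneLeadingTerms)
    (hparam : ModularParametrizationSupply) (hGZK : RankEqAnalyticRankLeOne) :
    Summit.BirchSwinnertonDyer.BirchSwinnertonDyer.Theses.SmallImageMuTransfer.PublishedInputsX9 :=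
  smallImageMuTransfer_publishedInputsX9_of_slim hBCS hGr
    (SkinnerUrban2014.realPeriodRat_eq_unit_mul_plusPeriod_of_mazur hMazur)
    ⟨Schneider1985_order_charGenerator.of_odd hSch, hPR⟩ hparam hGZK

end Summit.BirchSwinnertonDyer.BirchSwinnertonDyer.Theorems
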